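import Mathlib
import HarnessLib
import Literature.Analysis.FluidPDE.EnergyToolkit
import Literature.Analysis.FluidPDE.BackwardHeatPointwise
import Summits.NavierStokesRegularity.NavierStokesRegularity.Theorems.PoloidalWindowDoorPoloidalWindowRigiditySparseEnergyFarFlux

/-!
# Route `PoloidalWindowDoor`, crux `PoloidalWindowRigidity` (stmt-19708), line `sparse_energy` (cstrat g11) —
# stub S1 `stub_scaledEnergy`, near-apex flux: the slice flux of the local energy identity is LINEAR IN THE LOCAL ENERGY once the pressure
# is split on the ball into a constant, an `L²` near part and a far part of small oscillation (pressure-agnostic form of L1 `flux_le_near`)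

Seat ns-poloidal-K2-p2 g9 (successor of the interim LEAD-of-record on 19708; file `--supports`).  Companion of `…SparseEnergyFarFlux.abs_flux_le`
(the sup-rate/oscillation bound, good far from the apex) and of the round interface `…SparseEnergyWindow`: here the three flux terms are bounded
LINEARLY in the local energies, which is what the bootstrap in the radius needs near the apex (S1-NEAR-DESIGN-K2p2-g9 §2, L1):

* `abs_flux_le_near` — for a divergence-free `C¹` field `u` with `‖u‖ ≤ M`, a `C¹` scalar `p` which ON THE CLOSED BALL `B̄(a,2R)` splits as
  `p = c + p₁ + p₂` (`p₁` continuous; `|p₂(x) − p₂(y)| ≤ O` on the ball), and the cut-off `ψ = cutoff R (a − ·)` (`|Δψ| ≤ C_Δ/R²`, `‖Dψ‖ ≤ C_∇/R`):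
  `|∫ (Δψ|u|² + Dψ(u)|u|² + 2pDψ(u))| ≤ (C_Δ/R²)·I + (C_∇/R)·M·I + 2(C_∇/R)·(‖p₁‖_{L²(B̄)}·√I + O·√|B̄|·√I)`,  `I = ∫_{B̄(a,2R)} |u|²`
  (`∫Dψ(u) = 0` removes `c + p₂(a)`; Cauchy–Schwarz on the ball for the two pressure pieces).

The pressure split itself (near part = Newton potential of `∂ᵢ∂ⱼ(χuᵢuⱼ)` with `‖p₁‖_{L²} ≲ M‖u‖_{L²(B(a,8R))}`, far part harmonic with
`osc ≲ R Σ_k (2^kR)⁻⁴ ∫_{B(a,2^{k+1}R)}|u|²`) is being typed for the Type-I class by ns-es-p1 (`Literature/…/RieszPressureModConst`); this file does not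
depend on its spelling.

WHAT THIS IS NOT: not a claim about Navier–Stokes, not S1 — vector calculus on one time slice (bears_on LADDER-NS N0 via crux 19708, line sparse_energy,
stub S1). [folklore]
-/

noncomputable section

-- the summit and its single sub-problem share the name (CONVENTIONS §1), as in every Theorems file
set_option linter.dupNamespace false

namespace Summit.NavierStokesRegularity.NavierStokesRegularity.Theorems.PoloidalWindowDoorPoloidalWindowRigiditySparseEnergyNearFlux

open MeasureTheory Set Function Filter Topology Metric InnerProductSpace
open scoped RealInnerProductSpace InnerProductSpace Laplacian ENNReal
open Literature.Analysis Literature.Analysis.FluidPDE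
open Summit.NavierStokesRegularity.NavierStokesRegularity.Theorems.PoloidalWindowDoorPoloidalWindowRigiditySparseEnergyFarFlux

/-! ### `L²` tools on a closed ball -/

/-- A continuous real function is in `L²` of a closed ball. [folklore] -/
theorem memLp_two_restrict_closedBall_of_continuous {f : EuclideanSpace ℝ (Fin 3) → ℝ} (hf : Continuous f)
    (a : EuclideanSpace ℝ (Fin 3)) (r : ℝ) : MemLp f 2 (volume.restrict (closedBall a r)) := by
  rw [memLp_two_iff_integrable_sq hf.aestronglyMeasurable]
  exact ((hf.pow 2).continuousOn.integrableOn_compact (isCompact_closedBall a r))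

/-- A continuous vector field is in `L²` of a closed ball. [folklore] -/
theorem memLp_two_restrict_closedBall_of_continuous' {u : EuclideanSpace ℝ (Fin 3) → EuclideanSpace ℝ (Fin 3)} (hu : Continuous u)
    (a : EuclideanSpace ℝ (Fin 3)) (r : ℝ) : MemLp u 2 (volume.restrict (closedBall a r)) := by
  rw [memLp_two_iff_integrable_sq_norm hu.aestronglyMeasurable]
  exact ((hu.norm.pow 2).continuousOn.integrableOn_compact (isCompact_closedBall a r))

/-- Cauchy–Schwarz on the closed ball: `∫_{B̄} |p₁|·‖u‖ ≤ √(∫_{B̄} p₁²)·√(∫_{B̄} ‖u‖²)`. [folklore] -/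
theorem setIntegral_abs_mul_norm_le {p₁ : EuclideanSpace ℝ (Fin 3) → ℝ} {u : EuclideanSpace ℝ (Fin 3) → EuclideanSpace ℝ (Fin 3)}
    (hp₁ : Continuous p₁) (hu : Continuous u) (a : EuclideanSpace ℝ (Fin 3)) (r : ℝ) :
    ∫ x in closedBall a r, |p₁ x| * ‖u x‖ ≤
      Real.sqrt (∫ x in closedBall a r, p₁ x ^ 2) * Real.sqrt (∫ x in closedBall a r, ‖u x‖ ^ 2) := by
  have h := integral_norm_mul_norm_le_sqrt_mul_sqrt (memLp_two_restrict_closedBall_of_continuous hp₁ a r)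
    (memLp_two_restrict_closedBall_of_continuous' hu a r)
  simp only [Real.norm_eq_abs, sq_abs] at h
  exact h

/-- `∫_{B̄} ‖u‖ ≤ √|B̄| · √(∫_{B̄} ‖u‖²)`. [folklore] -/
theorem setIntegral_norm_le {u : EuclideanSpace ℝ (Fin 3) → EuclideanSpace ℝ (Fin 3)} (hu : Continuous u)
    (a : EuclideanSpace ℝ (Fin 3)) (r : ℝ) :
    ∫ x in closedBall a r, ‖u x‖ ≤
      Real.sqrt (volume (closedBall a r)).toReal * Real.sqrt (∫ x in closedBall a r, ‖u x‖ ^ 2) := by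
  haveI : Fact (volume (closedBall a r) < ∞) := ⟨measure_closedBall_lt_top⟩
  have h := Carleman.integral_le_sqrt_measure_mul_integral_sq (μ := volume.restrict (closedBall a r)) (f := fun x => ‖u x‖)
    (ae_of_all _ fun x => norm_nonneg _) hu.norm.aestronglyMeasurable
    ((hu.norm.pow 2).continuousOn.integrableOn_compact (isCompact_closedBall a r))
  rw [measureReal_def, Measure.restrict_apply_univ] at h
  rwa [Real.sqrt_mul ENNReal.toReal_nonneg] at h

/-! ### The near-apex flux bound -/

section Flux

variable {R : ℝ} {a : EuclideanSpace ℝ (Fin 3)} {ψ : EuclideanSpace ℝ (Fin 3) → ℝ}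
  (hψ : ψ = fun x => cutoff R (a - x))
include hψ

/-- **THE SLICE FLUX IS LINEAR IN THE LOCAL ENERGY once the pressure is split on the ball.**  For a divergence-free `C¹` field `u`
(`‖u‖ ≤ M`), a `C¹` scalar `p` with `p = c + p₁ + p₂` on `B̄(a,2R)` (`p₁, p₂` continuous, `|p₂ x − p₂ y| ≤ O` on the ball) and the cut-off
`ψ = cutoff R (a − ·)`:
`|∫ (Δψ|u|² + Dψ(u)|u|² + 2pDψ(u))| ≤ (C_Δ/R²)I + (C_∇/R)·M·I + 2(C_∇/R)(√(∫_{B̄}p₁²)·√I + O·√|B̄|·√I)`, `I = ∫_{B̄(a,2R)}|u|²`. [folklore] -/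
theorem abs_flux_le_near (hR : 0 < R) {Cl Cg : ℝ}
    (hCl : ∀ R : ℝ, 0 < R → ∀ x : EuclideanSpace ℝ (Fin 3), |(Δ (cutoff R : EuclideanSpace ℝ (Fin 3) → ℝ)) x| ≤ Cl / R ^ 2)
    (hCg : ∀ R : ℝ, 0 < R → ∀ x : EuclideanSpace ℝ (Fin 3), ‖fderiv ℝ (cutoff R : EuclideanSpace ℝ (Fin 3) → ℝ) x‖ ≤ Cg / R)
    {u : EuclideanSpace ℝ (Fin 3) → EuclideanSpace ℝ (Fin 3)} {p p₁ p₂ : EuclideanSpace ℝ (Fin 3) → ℝ} {c : ℝ}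
    (hu : ContDiff ℝ 1 u) (hdiv : ∀ x, VectorCalculus.divergence u x = 0) (hp : ContDiff ℝ 1 p)
    (hp₁ : Continuous p₁) (hdec : ∀ x ∈ closedBall a (2 * R), p x = c + p₁ x + p₂ x)
    {M O : ℝ} (hO : 0 ≤ O) (huM : ∀ x, ‖u x‖ ≤ M)
    (hosc : ∀ x ∈ closedBall a (2 * R), ∀ y ∈ closedBall a (2 * R), |p₂ x - p₂ y| ≤ O) :
    |∫ x, ((Δ ψ) x * ‖u x‖ ^ 2 + fderiv ℝ ψ x (u x) * ‖u x‖ ^ 2 + 2 * (p x * fderiv ℝ ψ x (u x)))| ≤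
      Cl / R ^ 2 * (∫ x in closedBall a (2 * R), ‖u x‖ ^ 2) + Cg / R * M * (∫ x in closedBall a (2 * R), ‖u x‖ ^ 2) +
        2 * (Cg / R) * (Real.sqrt (∫ x in closedBall a (2 * R), p₁ x ^ 2) * Real.sqrt (∫ x in closedBall a (2 * R), ‖u x‖ ^ 2) +
          O * Real.sqrt (volume (closedBall a (2 * R))).toReal * Real.sqrt (∫ x in closedBall a (2 * R), ‖u x‖ ^ 2)) := by
  have hψ2 : ContDiff ℝ 2 ψ := cutoffT_contDiff hψ
  have hψ1 : ContDiff ℝ 1 ψ := cutoffT_contDiff hψ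
  have hψc : HasCompactSupport ψ := cutoffT_hasCompactSupport hψ hR
  have hCl0 : 0 ≤ Cl / R ^ 2 := le_trans (abs_nonneg _) (hCl R hR 0)
  have hCg0 : 0 ≤ Cg / R := le_trans (norm_nonneg _) (hCg R hR 0)
  set B : Set (EuclideanSpace ℝ (Fin 3)) := closedBall a (2 * R) with hB
  set I : ℝ := ∫ x in B, ‖u x‖ ^ 2 with hI
  -- continuity of the players
  have hcΔ : Continuous (Δ ψ) := continuous_laplacian hψ2
  have hcD : Continuous fun x => fderiv ℝ ψ x (u x) := (hψ1.continuous_fderiv one_ne_zero).clm_apply hu.continuous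
  have hcu2 : Continuous fun x => ‖u x‖ ^ 2 := (hu.continuous.norm).pow 2
  have hout : ∀ x, x ∉ B → (Δ ψ) x = 0 ∧ fderiv ℝ ψ x = 0 := by
    intro x hx
    rw [hB, mem_closedBall, not_le] at hx
    exact cutoffT_derivs_eq_zero hψ hR hx
  have hK : ∀ {F : EuclideanSpace ℝ (Fin 3) → ℝ}, (∀ x, x ∉ B → F x = 0) → HasCompactSupport F :=
    fun hF => HasCompactSupport.intro (isCompact_closedBall a (2 * R)) hF
  -- the three pieces
  set f₁ : EuclideanSpace ℝ (Fin 3) → ℝ := fun x => (Δ ψ) x * ‖u x‖ ^ 2 with hf₁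
  set f₂ : EuclideanSpace ℝ (Fin 3) → ℝ := fun x => fderiv ℝ ψ x (u x) * ‖u x‖ ^ 2 with hf₂
  set f₃ : EuclideanSpace ℝ (Fin 3) → ℝ := fun x => 2 * (p x * fderiv ℝ ψ x (u x)) with hf₃
  have hf₁0 : ∀ x, x ∉ B → f₁ x = 0 := fun x hx => by simp only [hf₁, (hout x hx).1, zero_mul]
  have hf₂0 : ∀ x, x ∉ B → f₂ x = 0 := fun x hx => by simp only [hf₂, (hout x hx).2]; simp
  have hf₃0 : ∀ x, x ∉ B → f₃ x = 0 := fun x hx => by simp only [hf₃, (hout x hx).2]; simp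
  have hf₁c : Continuous f₁ := hcΔ.mul hcu2
  have hf₂c : Continuous f₂ := hcD.mul hcu2
  have hf₃c : Continuous f₃ := continuous_const.mul (hp.continuous.mul hcD)
  have hf₁i : Integrable f₁ := hf₁c.integrable_of_hasCompactSupport (hK hf₁0)
  have hf₂i : Integrable f₂ := hf₂c.integrable_of_hasCompactSupport (hK hf₂0)
  have hf₃i : Integrable f₃ := hf₃c.integrable_of_hasCompactSupport (hK hf₃0)
  have hsplit : ∫ x, ((Δ ψ) x * ‖u x‖ ^ 2 + fderiv ℝ ψ x (u x) * ‖u x‖ ^ 2 + 2 * (p x * fderiv ℝ ψ x (u x))) =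
      (∫ x, f₁ x) + (∫ x, f₂ x) + ∫ x, f₃ x := by
    have e : (fun x => (Δ ψ) x * ‖u x‖ ^ 2 + fderiv ℝ ψ x (u x) * ‖u x‖ ^ 2 + 2 * (p x * fderiv ℝ ψ x (u x))) =
        fun x => (f₁ x + f₂ x) + f₃ x := by
      funext x; simp only [hf₁, hf₂, hf₃]
    rw [e]
    have h12 := integral_add hf₁i hf₂i
    have h123 := integral_add (hf₁i.add hf₂i) hf₃i
    simp only [Pi.add_apply] at h123
    rw [h123, h12]
  -- integrability of the comparison functions on the ball
  have hIu2 : IntegrableOn (fun x => ‖u x‖ ^ 2) B := hcu2.continuousOn.integrableOn_compact (isCompact_closedBall a (2 * R))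
  have hball_ae : ∀ {P : EuclideanSpace ℝ (Fin 3) → Prop}, (∀ x ∈ B, P x) → ∀ᵐ x ∂(volume.restrict B), P x :=
    fun h => (ae_restrict_iff' measurableSet_closedBall).2 (ae_of_all _ h)
  -- (1) the diffusive term
  have h1 : |∫ x, f₁ x| ≤ Cl / R ^ 2 * I := by
    rw [← setIntegral_eq_integral_of_forall_compl_eq_zero (s := B) fun x hx => hf₁0 x hx, ← Real.norm_eq_abs, hI, ← integral_const_mul]
    refine norm_integral_le_of_norm_le (hIu2.const_mul _) (hball_ae fun x _ => ?_)
    simp only [hf₁]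
    rw [Real.norm_eq_abs, abs_mul, abs_of_nonneg (sq_nonneg ‖u x‖)]
    exact mul_le_mul_of_nonneg_right (cutoffT_bounds hψ hR hCl hCg x).1 (sq_nonneg _)
  -- (2) the cubic term
  have hDψu : ∀ x, |fderiv ℝ ψ x (u x)| ≤ Cg / R * ‖u x‖ := fun x => by
    rw [← Real.norm_eq_abs]
    exact (ContinuousLinearMap.le_opNorm _ _).trans (mul_le_mul_of_nonneg_right (cutoffT_bounds hψ hR hCl hCg x).2 (norm_nonneg _))
  have h2 : |∫ x, f₂ x| ≤ Cg / R * M * I := by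
    rw [← setIntegral_eq_integral_of_forall_compl_eq_zero (s := B) fun x hx => hf₂0 x hx, ← Real.norm_eq_abs, hI, ← integral_const_mul]
    refine norm_integral_le_of_norm_le (hIu2.const_mul _) (hball_ae fun x _ => ?_)
    simp only [hf₂]
    rw [Real.norm_eq_abs, abs_mul, abs_of_nonneg (sq_nonneg ‖u x‖)]
    refine mul_le_mul_of_nonneg_right ((hDψu x).trans ?_) (sq_nonneg _)
    exact mul_le_mul_of_nonneg_left (huM x) hCg0
  -- (3) the pressure term: remove the constant `c + p₂(a)`, then split
  have hmean : ∫ x, fderiv ℝ ψ x (u x) = 0 := integral_fderiv_apply_eq_zero_of_divFree hψ1 hψc hu hdiv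
  have hcDi : Integrable fun x => fderiv ℝ ψ x (u x) := hcD.integrable_of_hasCompactSupport (hK fun x hx => by rw [(hout x hx).2]; simp)
  set g : EuclideanSpace ℝ (Fin 3) → ℝ := fun x => 2 * ((p x - (c + p₂ a)) * fderiv ℝ ψ x (u x)) with hg
  have hg0 : ∀ x, x ∉ B → g x = 0 := fun x hx => by simp only [hg, (hout x hx).2]; simp
  have hfg : ∫ x, f₃ x = ∫ x, g x := by
    have hgf : ∀ x, g x = f₃ x - 2 * (c + p₂ a) * fderiv ℝ ψ x (u x) := fun x => by simp only [hg, hf₃]; ring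
    have hz : ∫ x, 2 * (c + p₂ a) * fderiv ℝ ψ x (u x) = 0 := by rw [integral_const_mul, hmean, mul_zero]
    rw [integral_congr_ae (Eventually.of_forall hgf), integral_sub hf₃i (hcDi.const_mul _), hz, sub_zero]
  have hgB : ∀ x ∈ B, ‖g x‖ ≤ 2 * (Cg / R) * (|p₁ x| * ‖u x‖ + O * ‖u x‖) := by
    intro x hx
    have hpx : p x - (c + p₂ a) = p₁ x + (p₂ x - p₂ a) := by rw [hdec x hx]; ring
    simp only [hg]
    rw [hpx, Real.norm_eq_abs, abs_mul, abs_two, abs_mul]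
    have ho := hosc x hx a (mem_closedBall_self (by positivity))
    have hsum : |p₁ x + (p₂ x - p₂ a)| ≤ |p₁ x| + O := (abs_add_le _ _).trans (by linarith)
    calc 2 * (|p₁ x + (p₂ x - p₂ a)| * |fderiv ℝ ψ x (u x)|)
        ≤ 2 * ((|p₁ x| + O) * (Cg / R * ‖u x‖)) :=
          mul_le_mul_of_nonneg_left (mul_le_mul hsum (hDψu x) (abs_nonneg _) (by positivity)) zero_le_two
      _ = 2 * (Cg / R) * (|p₁ x| * ‖u x‖ + O * ‖u x‖) := by ring
  have hIpu : IntegrableOn (fun x => |p₁ x| * ‖u x‖ + O * ‖u x‖) B :=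
    (((continuous_abs.comp hp₁).mul hu.continuous.norm).add (continuous_const.mul hu.continuous.norm)).continuousOn.integrableOn_compact
      (isCompact_closedBall a (2 * R))
  have h3 : |∫ x, f₃ x| ≤ 2 * (Cg / R) * (Real.sqrt (∫ x in B, p₁ x ^ 2) * Real.sqrt I +
      O * Real.sqrt (volume B).toReal * Real.sqrt I) := by
    rw [hfg, ← setIntegral_eq_integral_of_forall_compl_eq_zero (s := B) fun x hx => hg0 x hx, ← Real.norm_eq_abs]
    refine (norm_integral_le_of_norm_le (hIpu.const_mul (2 * (Cg / R))) (hball_ae fun x hx => hgB x hx)).trans ?_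
    rw [integral_const_mul]
    refine mul_le_mul_of_nonneg_left ?_ (by positivity)
    have hi1 : IntegrableOn (fun x => |p₁ x| * ‖u x‖) B :=
      ((continuous_abs.comp hp₁).mul hu.continuous.norm).continuousOn.integrableOn_compact (isCompact_closedBall a (2 * R))
    have hi2 : IntegrableOn (fun x => O * ‖u x‖) B :=
      (continuous_const.mul hu.continuous.norm).continuousOn.integrableOn_compact (isCompact_closedBall a (2 * R))
    rw [integral_add hi1 hi2, integral_const_mul, hI]
    exact add_le_add (setIntegral_abs_mul_norm_le hp₁ hu.continuous a (2 * R))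
      (by rw [mul_assoc]; exact mul_le_mul_of_nonneg_left (setIntegral_norm_le hu.continuous a (2 * R)) hO)
  -- assemble
  rw [hsplit]
  calc |(∫ x, f₁ x) + (∫ x, f₂ x) + ∫ x, f₃ x| ≤ |∫ x, f₁ x| + |∫ x, f₂ x| + |∫ x, f₃ x| :=
        (abs_add_le _ _).trans (add_le_add (abs_add_le _ _) le_rfl)
    _ ≤ _ := by rw [hI] at h1 h2 h3; linarith

end Flux

end Summit.NavierStokesRegularity.NavierStokesRegularity.Theorems.PoloidalWindowDoorPoloidalWindowRigiditySparseEnergyNearFlux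

end
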